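import Literature.NumberTheory.EllipticCurves.PAdicOneVariableInverseTransformMahler
import HarnessLib

/-!
# A bounded distribution on `ℤ_p` is DETERMINED by its Mahler moments `∫ (x choose j) dμ`; the masses of
# the residue classes as Mahler series; dilation by a unit (de Shalit 1987, I.3.1–3.4: "the measure
# `μ` ↔ its power series `P_μ`", and `∫ f(ux) dμ`)

De Shalit 1987, I.3.1 (p. 16): "(1) `P_μ(S) = ∫ (1+S)^x dμ(x) = Σ_k (∫ (x choose k) dμ) S^k` […] `μ ↦ P_μ` is
an isomorphism"; I.3.4 Lemma (ii) (p. 18): the measure of `g ∘ [u]` is the image of the measure of `g`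
under `x ↦ ux` (`u ∈ ℤ_p^×`).

`PAdicOneVariableInverseTransform{,Mahler}.lean` built, from a power series `P` with bounded
coefficients, the distribution `D_P` with `∫ (x choose j) dD_P = [S^j]P` and `∫ f dD_P = Σ_j [S^j]P Δ^j[f](0)`.
This file proves the converse bookkeeping for an ARBITRARY bounded distribution `D` on `ℤ_p`
(values in a complete non-archimedean field over `ℚ_p`):

* §1 `amiceCoeff D j = ∫ (x choose j) dD` (norm `≤ ‖D‖`), **`hasSum_integral_mahler`**:
  `∫ f dD = Σ_j (∫ (x choose j) dD) · Δ^j[f](0)` for every continuous `ℤ_p`-valued `f` (Mahler), hence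
  **`hasSum_μ`** / `μ_eq_tsum`: `D(a + pⁿℤ_p) = Σ_j amiceCoeff D j · e_j(n, a)`, the UNIQUENESS theorem
  **`μ_eq_of_integral_mahlerFun₁_eq`** (two bounded distributions with the same Mahler moments have the
  same masses), and the round trip **`invAmice₁_amice_μ`**: `D_{P_D} = D` for `P_D = Σ_j amiceCoeff D j S^j`;
* §2 **dilation by a unit** `u ∈ ℤ_p^×`: `mulUnit u D` (`(u_* D)(c) = D(u⁻¹c)`), `integral_mulUnit`:
  `∫ f d(u_*D) = ∫ f(ux) dD(x)` — the operation under which the elliptic-unit measures transform when the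
  unit is moved by `σ ∈ Gal` (`g_{σβ} = g_β ∘ [κ(σ)]`), i.e. the `U_0`-equivariance input of
  `GroupDistribution.induce` read on `ℤ_p^×`.

Everything is a definition with a body or a theorem; no named facts, no instances, no `sorry`.

## References

* [deShalit1987] E. de Shalit, *Iwasawa theory of elliptic curves with complex multiplication* (1987),
  I.3.1 (1)–(3) (p. 16), I.3.3 (8) (p. 17), I.3.4 Lemma (p. 18).
* [Washington1997] L. C. Washington, *Introduction to Cyclotomic Fields*, GTM 83, §12.2.
-/

noncomputable section

open Filter Topology Finset
open scoped fwdDiff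

namespace Literature.NumberTheory.EllipticCurves

namespace BoundedDistribution

variable {p : ℕ} [Fact p.Prime]
variable {𝕜 : Type*} [NormedField 𝕜] [NormedAlgebra ℚ_[p] 𝕜] [IsUltrametricDist 𝕜] [CompleteSpace 𝕜]
variable (D : BoundedDistribution (ProfiniteTower.padicInt p) 𝕜)

/-! ### §1. The Mahler moments determine the distribution -/

/-- **The Mahler moments (Amice coefficients) `∫ (x choose j) dD`** of a bounded distribution on `ℤ_p`.
[cite: deShalit1987, I.3.1 (1) (p. 16)] -/
def amiceCoeff (j : ℕ) : 𝕜 := D.integral (mahlerFun₁ 𝕜 j)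

omit [IsUltrametricDist 𝕜] [CompleteSpace 𝕜] in
/-- Unfolding `amiceCoeff`. [cite: deShalit1987, I.3.1 (1) (p. 16)] -/
theorem amiceCoeff_def (j : ℕ) : D.amiceCoeff j = D.integral (mahlerFun₁ 𝕜 j) := rfl

omit [IsUltrametricDist 𝕜] [CompleteSpace 𝕜] in
/-- `‖(x choose j)‖ ≤ 1` read in `𝕜`. [cite: deShalit1987, I.3.1 (1) (p. 16)] -/
theorem norm_mahlerFun₁_le_one (j : ℕ) (x : ℤ_[p]) : ‖mahlerFun₁ 𝕜 j x‖ ≤ 1 := by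
  rw [mahlerFun₁_apply, norm_padicIntCast]; exact PadicInt.norm_le_one _

/-- `‖∫ (x choose j) dD‖ ≤ ‖D‖`. [cite: deShalit1987, I.3.1 (1) (p. 16)] -/
theorem norm_amiceCoeff_le (j : ℕ) : ‖D.amiceCoeff j‖ ≤ D.bound := by
  have h := D.norm_integral_le (uniformContinuous_mahlerFun₁ j) zero_le_one (norm_mahlerFun₁_le_one j)
  rwa [mul_one] at h

/-- **The integral of a finite Mahler sum** `Σ_{j<N} a_j (x choose j)` is `Σ_{j<N} (∫ (x choose j) dD) a_j`.
[cite: deShalit1987, I.3.3 (8) (p. 17)] -/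
theorem integral_sum_mahlerTerm (a : ℕ → ℤ_[p]) (N : ℕ) :
    D.integral (fun x ↦ padicIntCast 𝕜 ((∑ j ∈ Finset.range N, PadicInt.mahlerTerm (a j) j :
        C(ℤ_[p], ℤ_[p])) x)) = ∑ j ∈ Finset.range N, D.amiceCoeff j * padicIntCast 𝕜 (a j) := by
  have hfun : (fun x ↦ padicIntCast 𝕜 ((∑ j ∈ Finset.range N, PadicInt.mahlerTerm (a j) j :
      C(ℤ_[p], ℤ_[p])) x)) = fun x ↦ ∑ j ∈ Finset.range N, mahlerFun₁ 𝕜 j x * padicIntCast 𝕜 (a j) := by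
    funext x
    rw [ContinuousMap.coe_sum, Finset.sum_apply, map_sum]
    refine Finset.sum_congr rfl fun j _ ↦ ?_
    rw [PadicInt.mahlerTerm_apply, smul_eq_mul, map_mul, mahlerFun₁_apply]
  rw [hfun, D.integral_finset_sum _
    (fun j _ ↦ uniformContinuous_mul_const (uniformContinuous_mahlerFun₁ j) _)]
  refine Finset.sum_congr rfl fun j _ ↦ ?_
  rw [D.integral_mul_const _ (uniformContinuous_mahlerFun₁ j), amiceCoeff_def]

/-- The terms `(∫ (x choose j) dD) · x_j` are summable for every null sequence `x_j → 0` in `ℤ_p`.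
[cite: deShalit1987, I.3.3 (8) (p. 17)] -/
theorem summable_amiceCoeff_mul {x : ℕ → ℤ_[p]} (hx : Tendsto x atTop (𝓝 0)) :
    Summable fun j : ℕ ↦ D.amiceCoeff j * padicIntCast 𝕜 (x j) := by
  refine summable_mul_of_tendsto_zero D.norm_amiceCoeff_le ?_
  have h := ((continuous_padicIntCast (𝕜 := 𝕜)).tendsto 0).comp hx
  rwa [Function.comp_def, map_zero] at h

/-- **Integration via Mahler coefficients, for ANY bounded distribution**:
`Σ_j (∫ (x choose j) dD) · Δ^j[f](0) = ∫ f dD` for every continuous `ℤ_p`-valued `f` (read in `𝕜`).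
[cite: deShalit1987, I.3.3 (8) (p. 17)] [cite: Washington1997, §12.2] -/
theorem hasSum_integral_mahler (f : C(ℤ_[p], ℤ_[p])) :
    HasSum (fun j : ℕ ↦ D.amiceCoeff j * padicIntCast 𝕜 (Δ_[1] ^[j] (⇑f) 0))
      (D.integral (fun x ↦ padicIntCast 𝕜 (f x))) := by
  set a : ℕ → ℤ_[p] := fun j ↦ Δ_[1] ^[j] (⇑f) 0 with ha
  set F : ℕ → C(ℤ_[p], ℤ_[p]) := fun N ↦ ∑ j ∈ Finset.range N, PadicInt.mahlerTerm (a j) j with hF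
  have hMahler : Tendsto F atTop (𝓝 f) := (PadicInt.hasSum_mahler f).tendsto_sum_nat
  have hnorm : Tendsto (fun N ↦ ‖F N - f‖) atTop (𝓝 0) := tendsto_iff_norm_sub_tendsto_zero.mp hMahler
  have hint : Tendsto (fun N ↦ D.integral (fun x ↦ padicIntCast 𝕜 (F N x))) atTop
      (𝓝 (D.integral (fun x ↦ padicIntCast 𝕜 (f x)))) := by
    refine D.tendsto_integral_of_forall_norm_sub_le
      (F := fun N x ↦ padicIntCast 𝕜 (F N x)) (f := fun x ↦ padicIntCast 𝕜 (f x))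
      (fun N ↦ CompactSpace.uniformContinuous_of_continuous
        (continuous_padicIntCast.comp (F N).continuous))
      (CompactSpace.uniformContinuous_of_continuous (continuous_padicIntCast.comp f.continuous))
      (e := fun N ↦ ‖F N - f‖) (fun N ↦ norm_nonneg _) (fun N x ↦ ?_) hnorm
    rw [← map_sub, norm_padicIntCast, ← ContinuousMap.sub_apply]
    exact (F N - f).norm_coe_le_norm x
  have hpartial : ∀ N, D.integral (fun x ↦ padicIntCast 𝕜 (F N x)) =
      ∑ j ∈ Finset.range N, D.amiceCoeff j * padicIntCast 𝕜 (a j) :=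
    fun N ↦ D.integral_sum_mahlerTerm a N
  simp_rw [hpartial] at hint
  have hs : Summable fun j : ℕ ↦ D.amiceCoeff j * padicIntCast 𝕜 (a j) :=
    D.summable_amiceCoeff_mul (PadicInt.fwdDiff_tendsto_zero f)
  have heq : ∑' j, D.amiceCoeff j * padicIntCast 𝕜 (a j) = D.integral (fun x ↦ padicIntCast 𝕜 (f x)) :=
    tendsto_nhds_unique hs.tendsto_sum_tsum_nat hint
  rw [← heq]
  exact hs.hasSum

omit [CompleteSpace 𝕜] in
/-- **The mass of a residue class is the integral of its indicator** (a locally constant function: the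
Riemann sums are eventually constant). [cite: deShalit1987, I.3.1 (p. 16)] -/
theorem μ_eq_integral_cellIndicator (n : ℕ) (a : ZMod (p ^ n)) :
    D.μ n a = D.integral (fun x ↦ padicIntCast 𝕜 (cellIndicator n a x)) := by
  rw [D.integral_eq_sum_of_factorsThrough (m := n) (fun c : ZMod (p ^ n) ↦ if c = a then (1 : 𝕜) else 0)
    (fun x ↦ ?_)]
  · refine ((Finset.sum_eq_single_of_mem (a : (ProfiniteTower.padicInt p).Cell n) (Finset.mem_univ _)
      fun b _ hb ↦ ?_).trans ?_).symm
    · have hb' : ¬ ((b : ZMod (p ^ n)) = a) := hb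
      rw [if_neg hb', mul_zero]
    · rw [if_pos rfl, mul_one]
  · rw [cellIndicator_apply, ProfiniteTower.padicInt_proj]
    by_cases h : PadicInt.toZModPow n x = a
    · rw [if_pos h, if_pos h, map_one]
    · rw [if_neg h, if_neg h, map_zero]

/-- **The masses as Mahler series: `D(a + pⁿℤ_p) = Σ_j (∫ (x choose j) dD) · e_j(n, a)`.**
[cite: deShalit1987, I.3.1 (1) (p. 16), I.3.3 (8) (p. 17)] -/
theorem hasSum_μ (n : ℕ) (a : ZMod (p ^ n)) :
    HasSum (fun j : ℕ ↦ D.amiceCoeff j * padicIntCast 𝕜 (cellMahlerCoeff n a j)) (D.μ n a) := by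
  rw [μ_eq_integral_cellIndicator]
  exact D.hasSum_integral_mahler (cellIndicator n a)

/-- The `tsum` form of `hasSum_μ`. [cite: deShalit1987, I.3.1 (1) (p. 16)] -/
theorem μ_eq_tsum (n : ℕ) (a : ZMod (p ^ n)) :
    D.μ n a = ∑' j : ℕ, D.amiceCoeff j * padicIntCast 𝕜 (cellMahlerCoeff n a j) :=
  (D.hasSum_μ n a).tsum_eq.symm

/-- **UNIQUENESS: a bounded distribution on `ℤ_p` is determined by its Mahler moments** — two bounded
distributions with `∫ (x choose j) dD = ∫ (x choose j) dD'` for all `j` have the same masses ("`μ ↦ P_μ`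
is injective"). [cite: deShalit1987, I.3.1 (1)–(3) (p. 16)] -/
theorem μ_eq_of_integral_mahlerFun₁_eq (D D' : BoundedDistribution (ProfiniteTower.padicInt p) 𝕜)
    (h : ∀ j, D.integral (mahlerFun₁ 𝕜 j) = D'.integral (mahlerFun₁ 𝕜 j)) (n : ℕ) (a : ZMod (p ^ n)) :
    D.μ n a = D'.μ n a := by
  rw [μ_eq_tsum, μ_eq_tsum]
  exact tsum_congr fun j ↦ by rw [amiceCoeff_def, amiceCoeff_def, h j]

/-- **The Amice transform `P_D = Σ_j (∫ (x choose j) dD) S^j`** of a bounded distribution on `ℤ_p`.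
[cite: deShalit1987, I.3.1 (1) (p. 16)] -/
def amice : PowerSeries 𝕜 := PowerSeries.mk D.amiceCoeff

omit [IsUltrametricDist 𝕜] [CompleteSpace 𝕜] in
/-- The coefficients of `P_D`. [cite: deShalit1987, I.3.1 (1) (p. 16)] -/
@[simp] theorem coeff_amice (j : ℕ) : PowerSeries.coeff j D.amice = D.amiceCoeff j := by
  rw [amice, PowerSeries.coeff_mk]

/-- The coefficients of `P_D` are bounded by `‖D‖`. [cite: deShalit1987, I.3.1 (2) (p. 16)] -/
theorem norm_coeff_amice_le (j : ℕ) : ‖PowerSeries.coeff j D.amice‖ ≤ D.bound := by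
  rw [coeff_amice]; exact D.norm_amiceCoeff_le j

/-- **The round trip `D_{P_D} = D`**: the distribution of the Amice transform of `D` has the masses of
`D` ("`μ ↦ P_μ` is an isomorphism onto the bounded power series", with `invAmice₁` as inverse).
[cite: deShalit1987, I.3.1 (1)–(3) (p. 16)] -/
theorem invAmice₁_amice_μ (n : ℕ) (a : ZMod (p ^ n)) :
    (invAmice₁ p D.amice D.norm_coeff_amice_le).μ n a = D.μ n a := by
  rw [invAmice₁_μ, invAmiceMass₁, μ_eq_tsum]
  exact tsum_congr fun j ↦ by rw [coeff_amice]

/-- Conversely `P_{D_P} = P`: the Amice transform of the distribution of `P` is `P`.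
[cite: deShalit1987, I.3.1 (1)–(3) (p. 16)] -/
theorem amice_invAmice₁ {P : PowerSeries 𝕜} {C : ℝ} (hC : ∀ k, ‖PowerSeries.coeff k P‖ ≤ C) :
    (invAmice₁ p P hC).amice = P := by
  ext j
  rw [coeff_amice, amiceCoeff_def, integral_invAmice₁_mahlerFun₁ hC j]

/-! ### §2. Dilation by a unit -/

/-- The reduction of a unit `u ∈ ℤ_p^×` modulo `p^n`, a unit of `ℤ/p^n`.
[cite: deShalit1987, I.3.4 (p. 18)] -/
def unitMod (n : ℕ) (u : ℤ_[p]ˣ) : (ZMod (p ^ n))ˣ :=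
  Units.map (PadicInt.toZModPow (p := p) n).toMonoidHom u

/-- The value of `unitMod`. [cite: deShalit1987, I.3.4 (p. 18)] -/
@[simp] theorem coe_unitMod (n : ℕ) (u : ℤ_[p]ˣ) :
    ((unitMod n u : (ZMod (p ^ n))ˣ) : ZMod (p ^ n)) = PadicInt.toZModPow n (u : ℤ_[p]) := rfl

/-- `toZModPow n` of `u⁻¹` is `(unitMod n u)⁻¹`. [cite: deShalit1987, I.3.4 (p. 18)] -/
theorem toZModPow_units_inv (n : ℕ) (u : ℤ_[p]ˣ) :
    PadicInt.toZModPow n ((u⁻¹ : ℤ_[p]ˣ) : ℤ_[p]) = (((unitMod n u)⁻¹ : (ZMod (p ^ n))ˣ) : ZMod (p ^ n)) := by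
  rw [unitMod, Units.coe_map_inv]
  rfl

/-- Reduction of `unitMod (n+1) u` to level `n`. [cite: deShalit1987, I.3.4 (p. 18)] -/
theorem castHom_unitMod (n : ℕ) (u : ℤ_[p]ˣ) :
    ZMod.castHom (pow_dvd_pow p n.le_succ) (ZMod (p ^ n)) ((unitMod (n + 1) u : (ZMod (p ^ (n + 1)))ˣ) :
      ZMod (p ^ (n + 1))) = (unitMod n u : (ZMod (p ^ n))ˣ) := by
  rw [coe_unitMod, coe_unitMod, ZMod.castHom_apply, PadicInt.cast_toZModPow n (n + 1) n.le_succ]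

/-- Reduction of `(unitMod (n+1) u)⁻¹` to level `n`. [cite: deShalit1987, I.3.4 (p. 18)] -/
theorem castHom_unitMod_inv (n : ℕ) (u : ℤ_[p]ˣ) :
    ZMod.castHom (pow_dvd_pow p n.le_succ) (ZMod (p ^ n))
        (((unitMod (n + 1) u)⁻¹ : (ZMod (p ^ (n + 1)))ˣ) : ZMod (p ^ (n + 1))) =
      (((unitMod n u)⁻¹ : (ZMod (p ^ n))ˣ) : ZMod (p ^ n)) := by
  have h : Units.map (ZMod.castHom (pow_dvd_pow p n.le_succ) (ZMod (p ^ n)) :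
      ZMod (p ^ (n + 1)) →+* ZMod (p ^ n)).toMonoidHom (unitMod (n + 1) u) = unitMod n u :=
    Units.ext (castHom_unitMod n u)
  rw [← h, Units.coe_map_inv]
  rfl

/-- `w · c` for a unit `w` of `ℤ/p^n` and a residue class `c` (kept as a named operation so that the
classes may be typed as cells of the `p`-adic tower). [cite: deShalit1987, I.3.4 (p. 18)] -/
def unitMul {n : ℕ} (w : (ZMod (p ^ n))ˣ) (c : ZMod (p ^ n)) : ZMod (p ^ n) := (w : ZMod (p ^ n)) * c

omit [Fact p.Prime] in
/-- Unfolding `unitMul`. [cite: deShalit1987, I.3.4 (p. 18)] -/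
theorem unitMul_def {n : ℕ} (w : (ZMod (p ^ n))ˣ) (c : ZMod (p ^ n)) :
    unitMul w c = (w : ZMod (p ^ n)) * c := rfl

omit [Fact p.Prime] in
/-- `w⁻¹ (w c) = c`. [cite: deShalit1987, I.3.4 (p. 18)] -/
@[simp] theorem unitMul_inv_unitMul {n : ℕ} (w : (ZMod (p ^ n))ˣ) (c : ZMod (p ^ n)) :
    unitMul w⁻¹ (unitMul w c) = c := Units.inv_mul_cancel_left _ _

omit [Fact p.Prime] in
/-- `w (w⁻¹ c) = c`. [cite: deShalit1987, I.3.4 (p. 18)] -/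
@[simp] theorem unitMul_unitMul_inv {n : ℕ} (w : (ZMod (p ^ n))ˣ) (c : ZMod (p ^ n)) :
    unitMul w (unitMul w⁻¹ c) = c := Units.mul_inv_cancel_left _ _

/-- Reduction to level `n` of `(unitMod (n+1) u)⁻¹ b`. [cite: deShalit1987, I.3.4 (p. 18)] -/
theorem castHom_unitMul_inv (n : ℕ) (u : ℤ_[p]ˣ) (b : ZMod (p ^ (n + 1))) :
    ZMod.castHom (pow_dvd_pow p n.le_succ) (ZMod (p ^ n)) (unitMul (unitMod (n + 1) u)⁻¹ b) =
      unitMul (unitMod n u)⁻¹ (ZMod.castHom (pow_dvd_pow p n.le_succ) (ZMod (p ^ n)) b) := by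
  rw [unitMul_def, unitMul_def, map_mul, castHom_unitMod_inv]

/-- Reduction to level `n` of `(unitMod (n+1) u) b`. [cite: deShalit1987, I.3.4 (p. 18)] -/
theorem castHom_unitMul (n : ℕ) (u : ℤ_[p]ˣ) (b : ZMod (p ^ (n + 1))) :
    ZMod.castHom (pow_dvd_pow p n.le_succ) (ZMod (p ^ n)) (unitMul (unitMod (n + 1) u) b) =
      unitMul (unitMod n u) (ZMod.castHom (pow_dvd_pow p n.le_succ) (ZMod (p ^ n)) b) := by
  rw [unitMul_def, unitMul_def, map_mul, castHom_unitMod]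

/-- **Dilation of a bounded distribution on `ℤ_p` by a unit**: `(u_* D)(c) = D(u⁻¹ c)` on residue
classes (the image of `D` under `x ↦ ux`). [cite: deShalit1987, I.3.4 Lemma (ii) (p. 18)] -/
def mulUnit (u : ℤ_[p]ˣ) : BoundedDistribution (ProfiniteTower.padicInt p) 𝕜 where
  μ n c := D.μ n (unitMul (unitMod n u)⁻¹ c)
  sum_fiber n c := by
    rw [← D.sum_fiber n (unitMul (unitMod n u)⁻¹ c)]
    -- the fiber of `c` is carried by `b ↦ u⁻¹ b` onto the fiber of `u⁻¹ c`
    refine Finset.sum_nbij' (fun b ↦ unitMul (unitMod (n + 1) u)⁻¹ b)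
      (fun b' ↦ unitMul (unitMod (n + 1) u) b') (fun b hb ↦ ?_) (fun b' hb' ↦ ?_)
      (fun b _ ↦ unitMul_unitMul_inv _ _) (fun b' _ ↦ unitMul_inv_unitMul _ _) (fun b _ ↦ rfl)
    · simp only [Finset.mem_filter, Finset.mem_univ, true_and, ProfiniteTower.padicInt_trans] at hb ⊢
      rw [castHom_unitMul_inv, hb]
    · simp only [Finset.mem_filter, Finset.mem_univ, true_and, ProfiniteTower.padicInt_trans] at hb' ⊢
      rw [castHom_unitMul, hb', unitMul_unitMul_inv]
  bound := D.bound
  bound_nonneg := D.bound_nonneg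
  norm_le n c := D.norm_le n _

omit [NormedAlgebra ℚ_[p] 𝕜] [IsUltrametricDist 𝕜] [CompleteSpace 𝕜] in
/-- The masses of `u_* D`. [cite: deShalit1987, I.3.4 Lemma (ii) (p. 18)] -/
@[simp] theorem mulUnit_μ (u : ℤ_[p]ˣ) (n : ℕ) (c : ZMod (p ^ n)) :
    (D.mulUnit u).μ n c = D.μ n (unitMul (unitMod n u)⁻¹ c) := rfl

omit [NormedAlgebra ℚ_[p] 𝕜] [IsUltrametricDist 𝕜] [CompleteSpace 𝕜] in
/-- **`(u_* D)(u b) = D(b)`** — the shape of the `U_0`-equivariance hypothesis of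
`GroupDistribution.induce` (`(D (h • β)).μ n (κ(h) a) = (D β).μ n a`).
[cite: deShalit1987, I.3.4 Lemma (ii) (p. 18)] -/
theorem mulUnit_μ_unitMul (u : ℤ_[p]ˣ) (n : ℕ) (b : ZMod (p ^ n)) :
    (D.mulUnit u).μ n (unitMul (unitMod n u) b) = D.μ n b := by
  rw [mulUnit_μ, unitMul_inv_unitMul]

omit [NormedAlgebra ℚ_[p] 𝕜] [IsUltrametricDist 𝕜] [CompleteSpace 𝕜] in
/-- The bound of `u_* D` is that of `D`. [cite: deShalit1987, I.3.4 Lemma (ii) (p. 18)] -/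
@[simp] theorem mulUnit_bound (u : ℤ_[p]ˣ) : (D.mulUnit u).bound = D.bound := rfl

/-- The point `u⁻¹ · (u b)~` lies in the class `b` (a second system of sample points).
[cite: deShalit1987, I.3.4 Lemma (ii) (p. 18)] -/
theorem proj_units_inv_mul_repr (u : ℤ_[p]ˣ) (n : ℕ) (b : ZMod (p ^ n)) :
    (ProfiniteTower.padicInt p).proj n (((u⁻¹ : ℤ_[p]ˣ) : ℤ_[p]) *
      (ProfiniteTower.padicInt p).repr n (unitMul (unitMod n u) b)) = b := by
  rw [ProfiniteTower.padicInt_proj, map_mul, toZModPow_units_inv, ← ProfiniteTower.padicInt_proj,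
    (ProfiniteTower.padicInt p).proj_repr, ← unitMul_def, unitMul_inv_unitMul]

omit [NormedAlgebra ℚ_[p] 𝕜] [IsUltrametricDist 𝕜] [CompleteSpace 𝕜] in
/-- The Riemann sums of `u_* D` are Riemann sums of `D` for `f(ux)` with moved sample points.
[cite: deShalit1987, I.3.4 Lemma (ii) (p. 18)] -/
theorem riemannSum_mulUnit (u : ℤ_[p]ˣ) (f : ℤ_[p] → 𝕜) (n : ℕ) :
    (D.mulUnit u).riemannSum f n = ∑ b : ZMod (p ^ n), D.μ n b *
      (fun x ↦ f ((u : ℤ_[p]) * x)) (((u⁻¹ : ℤ_[p]ˣ) : ℤ_[p]) *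
        (ProfiniteTower.padicInt p).repr n (unitMul (unitMod n u) b)) := by
  rw [riemannSum_def]
  refine Finset.sum_nbij' (fun c ↦ unitMul (unitMod n u)⁻¹ c) (fun b ↦ unitMul (unitMod n u) b)
    (fun _ _ ↦ Finset.mem_univ _) (fun _ _ ↦ Finset.mem_univ _) (fun c _ ↦ unitMul_unitMul_inv _ _)
    (fun b _ ↦ unitMul_inv_unitMul _ _) (fun c _ ↦ ?_)
  simp only [unitMul_unitMul_inv, ← mul_assoc, Units.mul_inv, one_mul]
  rfl

omit [NormedAlgebra ℚ_[p] 𝕜] in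
/-- **`∫ f d(u_*D) = ∫ f(ux) dD(x)`** for uniformly continuous `f`.
[cite: deShalit1987, I.3.4 Lemma (ii) (p. 18)] -/
theorem integral_mulUnit (u : ℤ_[p]ˣ) {f : ℤ_[p] → 𝕜} (hf : UniformContinuous f) :
    (D.mulUnit u).integral f = D.integral (fun x ↦ f ((u : ℤ_[p]) * x)) := by
  have hg : UniformContinuous (fun x : ℤ_[p] ↦ f ((u : ℤ_[p]) * x)) := by
    have h := hf.comp (uniformContinuous_const_smul (M := ℤ_[p]) (X := ℤ_[p]) (u : ℤ_[p]))
    simpa only [Function.comp_def, smul_eq_mul] using h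
  have h1 : Tendsto ((D.mulUnit u).riemannSum f) atTop (𝓝 (D.integral (fun x ↦ f ((u : ℤ_[p]) * x)))) := by
    have heq : (D.mulUnit u).riemannSum f = fun n ↦ ∑ b : ZMod (p ^ n), D.μ n b *
        (fun x ↦ f ((u : ℤ_[p]) * x)) (((u⁻¹ : ℤ_[p]ˣ) : ℤ_[p]) *
          (ProfiniteTower.padicInt p).repr n (unitMul (unitMod n u) b)) :=
      funext fun n ↦ D.riemannSum_mulUnit u f n
    rw [heq]
    exact D.tendsto_sum_mul_apply_integral hg (fun n b ↦ proj_units_inv_mul_repr u n b)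
  exact tendsto_nhds_unique ((D.mulUnit u).tendsto_riemannSum_integral hf) h1

/-- **The moments of `u_* D`: `∫ x^k d(u_*D) = u^k ∫ x^k dD`.**
[cite: deShalit1987, I.3.4 Lemma (ii), I.3.5 (11) (p. 18)] -/
theorem integral_mulUnit_pow (u : ℤ_[p]ˣ) (k : ℕ) :
    (D.mulUnit u).integral (fun x ↦ padicIntCast 𝕜 (x ^ k)) =
      padicIntCast 𝕜 ((u : ℤ_[p]) ^ k) * D.integral (fun x ↦ padicIntCast 𝕜 (x ^ k)) := by
  have hk : UniformContinuous (fun x : ℤ_[p] ↦ padicIntCast 𝕜 (x ^ k)) :=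
    CompactSpace.uniformContinuous_of_continuous
      ((continuous_padicIntCast (𝕜 := 𝕜)).comp (continuous_pow k))
  rw [D.integral_mulUnit u hk, ← D.integral_const_mul _ hk]
  congr 1
  funext x
  rw [mul_pow, map_mul]

/-- **The Mahler moments of `u_* D`: `∫ (x choose j) d(u_*D) = ∫ (ux choose j) dD(x)`.**
[cite: deShalit1987, I.3.4 Lemma (ii) (p. 18)] -/
theorem integral_mulUnit_mahlerFun₁ (u : ℤ_[p]ˣ) (j : ℕ) :
    (D.mulUnit u).integral (mahlerFun₁ 𝕜 j) = D.integral (fun x ↦ mahlerFun₁ 𝕜 j ((u : ℤ_[p]) * x)) :=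
  D.integral_mulUnit u (uniformContinuous_mahlerFun₁ j)

/-- **Identification of a dilation by moments**: a bounded distribution `D'` whose Mahler moments are
`∫ (ux choose j) dD(x)` IS `u_* D` levelwise (this is how the measure of `g_β ∘ [u]` is identified
with `u_* μ_β`). [cite: deShalit1987, I.3.4 Lemma (ii) (p. 18)] -/
theorem μ_eq_mulUnit_μ_of_integral_mahlerFun₁_eq (u : ℤ_[p]ˣ)
    (D' : BoundedDistribution (ProfiniteTower.padicInt p) 𝕜)
    (h : ∀ j, D'.integral (mahlerFun₁ 𝕜 j) = D.integral (fun x ↦ mahlerFun₁ 𝕜 j ((u : ℤ_[p]) * x)))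
    (n : ℕ) (c : ZMod (p ^ n)) : D'.μ n c = (D.mulUnit u).μ n c :=
  μ_eq_of_integral_mahlerFun₁_eq D' (D.mulUnit u) (fun j ↦ by rw [h j, integral_mulUnit_mahlerFun₁]) n c

end BoundedDistribution

end Literature.NumberTheory.EllipticCurves

end
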